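import Summits.AtomisticToContinuum.HydrodynamicLimit.Theses.WarmColdDichotomy
import Summits.AtomisticToContinuum.HydrodynamicLimit.Theorems.OneFlightGossipEngineEnergyCurrentTailsPedigreeDocking
import Summits.AtomisticToContinuum.HydrodynamicLimit.Theorems.OneFlightGossipEngineEnergyCurrentTailsPedigreeLedgerSure
import Summits.AtomisticToContinuum.HydrodynamicLimit.Theorems.OneFlightGossipEngineEnergyCurrentTailsPedigreeMeasurable
import Summits.AtomisticToContinuum.HydrodynamicLimit.Theorems.OneFlightGossipEngineEnergyCurrentTailsPedigreeLevelInclusion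
import Summits.AtomisticToContinuum.HydrodynamicLimit.Theorems.OneFlightGossipEngineEnergyCurrentTailsPedigreeDataTails
import Summits.AtomisticToContinuum.HydrodynamicLimit.Theorems.OneFlightGossipEngineEnergyCurrentTailsPedigreeAssembly
import Summits.AtomisticToContinuum.HydrodynamicLimit.Theorems.OneFlightGossipEngineEnergyCurrentTailsPedigreeMergeIntake

/-!
# Line `pedigree-perpetuity` for the crux `EnergyCurrentTails` (stmt-AtomisticToContinuum-9235)
# — skeleton v3 (lead c3, prover-line-stmt-AtomisticToContinuum-9235-c3-0; re-homed on the landed Theorems files)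

Route `OneFlightGossipEngine` (rank 9; primary copy of the item: `WarmColdDichotomy.EnergyCurrentTails`,
definitionally the same `Prop`).  Idea card `Cruxes/EnergyCurrentTails/Ideas/pedigree-perpetuity.md`
(ideator 1), triage `TRIAGE-r1-{1,2,3}.md` (3 × pass, with sharpenings adopted below), line card
`Lines/pedigree-perpetuity.md`.

## The line in one paragraph

Follow the ENERGY LINEAGE of a particle `i` backwards from time `s`: at each collision go to the
PROJECTILE (the incoming particle with the larger pre-collisional energy).  Along the lineage the
carried energies obey the packet step `E_n ≤ s_n·E_{n+1} + q_n` (`s_n ∈ [0,1]` the followed branch's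
share of the projectile energy — a good = δ-splitting step has `s_n ≤ 1 − δ`, BOTH δ-neutral ends
(graze, dead-centre hop) have `s_n > 1 − δ`; `q_n` the partner's pre-energy), hence the backward
PERPETUITY `E_0 ≤ Σ_n q̃_n w_n + E_K w_K`, `w_n = Π_{j<n} s_j ≤ (1−δ)^{#good steps before n}`,
`q̃_n = (E_n − s_n E_{n+1})₊ ≤ q_n` (all PROVED here in abstract form, §1).  Split `q̃ = min(q̃,Θ₀) + λ`
(thermal quantum + LIFT).  Being at level `L·Θ₀` now forces one of: a long recent δ-NEUTRAL BLOCK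
(priced by `stub_neutralRunTails`, annealed, geometric in the length, union bound over blocks with
allowances `m+g+1`), a large DISCOUNTED WARM INTAKE `Λ = Σ λ_n w_n` (priced by `stub_mergeIntakeTails`),
a large discounted INHERITANCE from time `0` (no statistics needed: the cascade identity
`Σ_{heirs of j} w ≤ 1` of `stub_lineageLedger` + Gaussian data, `stub_initialEnergyTails`), or a huge
total energy (Gaussian data + conservation).  This gives the transfer statement `CensusDecay`
(expected level census `≤ B(N+1)L⁻⁴`, pointwise in `s ≤ t < T`) — `stub_censusAssembly` — which docks
to the crux by binning the cubic tail over levels — `stub_censusDocking`.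

## Status after cycle 1 (lead c3): 6 of 8 registered stubs LANDED, 2 OPEN (both crux-strength)

LANDED (namespace `…Theorems.EnergyCurrentTailsPedigree`, all `--supports stmt-AtomisticToContinuum-9235`, ACCEPTED):
vocabulary `…PedigreeObjects` p119207, tools `…PedigreeKinematics` p119223, `stub_censusDocking` p119348 (`…PedigreeDocking`),
`stub_lineageLedgerSure` p121734 (`…PedigreeLedgerSure`, + `…PedigreeLedgerKinematics` p120621), `stub_lineageMeasurable`
p120065 (`…PedigreeMeasurable`), `stub_levelInclusion` p120048 (`…PedigreeLevelInclusion`), `stub_initialEnergyTails`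
p120025 (`…PedigreeDataTails`), `stub_censusAssembly` p120938 (`…PedigreeAssembly`, + `…AssemblyConstants` p120359,
`…AssemblyNull` p120360, `…AssemblyInheritance` p120361); merge dock `mergeIntakeTails_of_gaussianCensusBound` p120747
(`…PedigreeMergeIntake`: `MergeIntakeTails` is CENSUS-STRENGTH — `Λ ≤ ‖vᵢ(s)‖²` surely); certified reduction
`energyCurrentTails_of_pedigreePrices : NeutralRunTails → MergeIntakeTails → crux` (`…PedigreeReduction`, p121964 pending build).
OPEN: `stub_neutralRunTails` (lead), `stub_mergeIntakeTails` (⟸ `GaussianCensusBound` of the sibling line, proved).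
This file now only `open`s the landed namespace; the definitions below in comments refer to the landed vocabulary.

## Stubs (1 closed + 7 open; lead c3 reshape of the planner's 1 + 5) and composition

* `stub_censusDocking`   : `CensusDecay → EnergyCurrentTails` — CLOSED IN THIS FILE (§4b: discrete layer
  cake `‖v‖⁴ ≤ Θ² + Σ_j(2j+3)Θ²𝟙{(j+1)Θ ≤ ‖v‖²}`, `lintegral_tsum`, p-series, then Chebyshev docking
  `energyCurrentTails_of_quarticMoment` = the landed `Theorems.LoschmidtTagging.stub_quarticDocking`
  re-targeted to the item's primary copy; standard axioms only)
* `stub_lineageLedgerSure` : sure kinematics of the lineage + energy cap + heir cascade     (L, provable now)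
* `stub_lineageMeasurable` : Liouville-a.e. measurability of the lineage data               (M–L, provable now)
* `stub_levelInclusion`    : sure ledger → the deterministic level inclusion (perpetuity)   (M, provable now)
* `stub_initialEnergyTails` : Gaussian facts of the local Gibbs DATA at `t = 0`             (M, provable now)
* `stub_neutralRunTails` : annealed geometric tails of energetic δ-neutral blocks           (crux-strength; HARDEST)
* `stub_mergeIntakeTails`: summable tails of the discounted warm intake `Λ`                 (crux-strength)
* `stub_censusAssembly`  : ledger → inclusion → data → runs → merges → `CensusDecay`        (M–L, provable now)

`EnergyCurrentTails_of : stub_lineageLedgerSure → stub_lineageMeasurable → stub_levelInclusion →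
stub_initialEnergyTails → stub_neutralRunTails → stub_mergeIntakeTails → stub_censusAssembly →
WarmColdDichotomy.EnergyCurrentTails`  (the vocabulary of §2–§4 lands verbatim as
`Theorems/OneFlightGossipEngineEnergyCurrentTailsPedigreeObjects.lean`, namespace
`…Theorems.EnergyCurrentTailsPedigree`; the skeleton is re-homed on it once built)
(sorry-free; the `OneFlightGossipEngine` copy of the decl is definitionally the same `Prop` — this file
imports only the primary route file `WarmColdDichotomy` so that it elaborates whenever that file is coherent;
`CensusDecay` also yields the uniform empirical quartic moment `quarticMoment_of_censusDecay`, i.e. the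
hypothesis of the lead's docking).

## Disproof honoured (`Cruxes/EnergyCurrentTails/Disproof.lean`, cycle 1)
§3 `energyCurrentTails_false_without_randomness(_inDomain)`: every statistical input is a statement
about the local Gibbs law (`stub_neutralRunTails`, `stub_mergeIntakeTails`, `stub_initialEnergyTails`);
§4 `energyCurrentTails_false_of_quadraticUI_only`: `CensusDecay` is a fourth-power census bound, false
for `twoPointLaw`; §5 `focusing_tree`/`reflectVel_perp`: the focusing pedigree is CHARGED — each node is a
dead-centre hop (δ-neutral, `s > 1−δ`, priced by `stub_neutralRunTails`) absorbing an energetic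
perpendicular partner (a LIFT, priced by `stub_mergeIntakeTails`); §6/§6b: no exponential moment of the
cubic functional anywhere (polynomial census currency); `EquilibriumRung.lean`: the `u₀ = 0` homogeneous
rung where impact parameters are provably uniform.
-/

noncomputable section

open MeasureTheory Set Filter
open scoped ENNReal InnerProductSpace BigOperators

namespace Summit.AtomisticToContinuum.HydrodynamicLimit.Cruxes.EnergyCurrentTails.PedigreePerpetuity

open Literature.MathematicalPhysics.KineticTheory Literature.Analysis.FluidPDE
open Summit.AtomisticToContinuum.HydrodynamicLimit.Theorems.EnergyCurrentTailsPedigree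

/-! ## §5 The registered stubs (v3: the landed ones are the tree theorems; 2 open) -/

namespace Holds

/-- **Stub 1 — CENSUS DOCKING**: LANDED (`…Theorems.EnergyCurrentTailsPedigree.stub_censusDocking`, p119348). -/
theorem stub_censusDocking :
    CensusDecay →
      Summit.AtomisticToContinuum.HydrodynamicLimit.Theses.WarmColdDichotomy.EnergyCurrentTails :=
  Summit.AtomisticToContinuum.HydrodynamicLimit.Theorems.EnergyCurrentTailsPedigree.stub_censusDocking

/-- **Stub 2a — LINEAGE LEDGER, SURE PART**: LANDED (p121734). -/
theorem stub_lineageLedgerSure : LineageLedgerSure :=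
  Summit.AtomisticToContinuum.HydrodynamicLimit.Theorems.EnergyCurrentTailsPedigree.stub_lineageLedgerSure

/-- **Stub 2b — LINEAGE LEDGER, MEASURABLE PART**: LANDED (p120065). -/
theorem stub_lineageMeasurable : LineageMeasurable :=
  Summit.AtomisticToContinuum.HydrodynamicLimit.Theorems.EnergyCurrentTailsPedigree.stub_lineageMeasurable

/-- **Stub 3 — LEVEL INCLUSION**: LANDED (p120048). -/
theorem stub_levelInclusion : LineageLedgerSure → LevelInclusion :=
  Summit.AtomisticToContinuum.HydrodynamicLimit.Theorems.EnergyCurrentTailsPedigree.stub_levelInclusion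

/-- **Stub 4 — GAUSSIAN FACTS OF THE DATA**: LANDED (p120025). -/
theorem stub_initialEnergyTails : InitialEnergyTails :=
  Summit.AtomisticToContinuum.HydrodynamicLimit.Theorems.EnergyCurrentTailsPedigree.stub_initialEnergyTails

/-- **Stub 5 — NEUTRAL-RUN TAILS** (crux-strength; HARDEST, OPEN, lead): the N-uniform, pre-shock, two-sided impact
freshness of energetic encounters along lineages (annealed, per block, geometric in the energetic prefix length).
A Palm-type (collision-indexed) statement: no proof by union bounds over time can be N-uniform (the lineage makes
`≍ N^{1/3}` transitions per unit time), so it needs per-flight conditioning technology off equilibrium. -/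
theorem stub_neutralRunTails : NeutralRunTails := by
  sorry

/-- **Stub 6 — MERGE-INTAKE TAILS** (crux-strength, OPEN): summable tails of the discounted warm intake. FINDING
(p120747): `Λ ≤ ‖vᵢ(s)‖²` surely, so this stub is CENSUS-STRENGTH — implied by the sibling line's
`GaussianCensusBound` (`mergeIntakeTails_of_gaussianCensusBound`) and, at exponent 4, equivalent to `CensusDecay`
modulo runs + data + ledger; the merge channel of this line is therefore NOT reduced below the census itself. -/
theorem stub_mergeIntakeTails : MergeIntakeTails := by
  sorry

/-- **Stub 7 — CENSUS ASSEMBLY**: LANDED (p120938). -/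
theorem stub_censusAssembly :
    LineageLedger → LevelInclusion → InitialEnergyTails → NeutralRunTails → MergeIntakeTails →
      CensusDecay :=
  Summit.AtomisticToContinuum.HydrodynamicLimit.Theorems.EnergyCurrentTailsPedigree.stub_censusAssembly

end Holds

/-! ## Stub statements by name (D-0027 §3.3) -/

/-- Statement of stub 1 (landed), by name. -/
def stub_censusDocking : Prop := type_of% Holds.stub_censusDocking
/-- Statement of stub 2a (landed), by name. -/
def stub_lineageLedgerSure : Prop := type_of% Holds.stub_lineageLedgerSure
/-- Statement of stub 2b (landed), by name. -/
def stub_lineageMeasurable : Prop := type_of% Holds.stub_lineageMeasurable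
/-- Statement of stub 3 (landed), by name. -/
def stub_levelInclusion : Prop := type_of% Holds.stub_levelInclusion
/-- Statement of stub 4 (landed), by name. -/
def stub_initialEnergyTails : Prop := type_of% Holds.stub_initialEnergyTails
/-- Statement of stub 5 (OPEN), by name. -/
def stub_neutralRunTails : Prop := type_of% Holds.stub_neutralRunTails
/-- Statement of stub 6 (OPEN), by name. -/
def stub_mergeIntakeTails : Prop := type_of% Holds.stub_mergeIntakeTails
/-- Statement of stub 7 (landed), by name. -/
def stub_censusAssembly : Prop := type_of% Holds.stub_censusAssembly

/-! ## §6 Composition (sorry-free): the two OPEN stubs imply the crux BY NAME -/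

/-- **THE SKELETON THEOREM** (primary copy of the item, `WarmColdDichotomy.EnergyCurrentTails`): the LANDED docking ∘
assembly ∘ (ledger, inclusion, data), fed with the two OPEN crux-strength stubs (= the tree theorem
`…Theorems.EnergyCurrentTailsPedigree.energyCurrentTails_of_pedigreePrices` once `…PedigreeReduction` is built). -/
theorem EnergyCurrentTails_of (h₅ : stub_neutralRunTails) (h₆ : stub_mergeIntakeTails) :
    Summit.AtomisticToContinuum.HydrodynamicLimit.Theses.WarmColdDichotomy.EnergyCurrentTails := by
  have hR : type_of% Holds.stub_neutralRunTails := h₅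
  have hW : type_of% Holds.stub_mergeIntakeTails := h₆
  exact Holds.stub_censusDocking (Holds.stub_censusAssembly
    (lineageLedger_of Holds.stub_lineageLedgerSure Holds.stub_lineageMeasurable)
    (Holds.stub_levelInclusion Holds.stub_lineageLedgerSure) Holds.stub_initialEnergyTails hR hW)

/-- **The line's closing theorem modulo the two OPEN registered stubs** (sorry-free once they are). -/
theorem EnergyCurrentTails_proof :
    Summit.AtomisticToContinuum.HydrodynamicLimit.Theses.WarmColdDichotomy.EnergyCurrentTails :=
  EnergyCurrentTails_of Holds.stub_neutralRunTails Holds.stub_mergeIntakeTails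

end Summit.AtomisticToContinuum.HydrodynamicLimit.Cruxes.EnergyCurrentTails.PedigreePerpetuity

end
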